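import Summits.QuantumFields.YangMills.Theorems.ForcedResponseSkewnessResponseLocalisationDefs
import Summits.QuantumFields.YangMills.Theorems.LangevinControlUVOSLegsFromFemtoAndGapStubCollar
import HarnessLib

/-!
# Route `ForcedResponseSkewness`, crux `ResponseLocalisation` (stmt-QuantumFields-24869), line «femto-collar»: toolkit for the
# collar transfer `ContactKernelSigR ⇐ FBL ∧ NearCovLaw`

Helper file (`--supports stmt-QuantumFields-24869`) of the lead `ym-line-frs-p1` (g3).  The kernel-level physics stub of line
«collar-kernel» (`ContactKernelSigR`: integrated near-insertion ceiling `Σ_{x ∈ B_R(z)} |κ₃^T(x,y,z)| ≤ κ·a(β)⁸` for the TORUS third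
cumulant, torus-uniform, pair `(y,z)` at unit-scale separation) is a COLLAR TRANSFER of two femto-cube statements — the spine's
frozen-boundary law `FBL` and a near-pair conditional-covariance law — by one torus DLR step around `y` and one around `z`, exactly as
`DlrCollarTransfer.stub_collar` derives `MomentBounds` from `FBL` (tree `abs_integral_prod_sub_mean_le`).  This file supplies the
pieces that are not specific to the crux:

* §1 torus representatives of the near ball: the cyclic representative of `x − z`, its norm = `torusDist`, injectivity
  on `box L`, the count `#{x ∈ box L : d_T(x,z) < ρ} ≤ (2ρ+1)⁴`, and a far coordinate `d_T(y,z)/2 ≤ |(y−z)_k|_T`;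
* §2 periodicity of the lifted action density (`dens x ∘ lift = dens x' ∘ lift` for `x ≡ x'`), hence of `torusK3` in its first slot;
  the shifted density `dens (z+w)` is a cylinder observable on the radius-`M+1` cube around `z` and sits at depth `≥ M+2−N` there;
* §3 kernel algebra `γ((F−p)(H−q)) = kerCov(F,H) + (γF − p)(γH − q)`, the torus mean of a collared observable, and the
  TWO-OBSERVABLE collar bound with separate tolerances `|⟨(A₁−⟨A₁⟩)(A₂−⟨A₂⟩)⟩| ≤ 4 ε₁ ε₂` (the tree's `(2ε)ⁿ` bound at `n = 2`
  after rescaling `A₂`).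

No summit is proved by any of this (leaf R2a `BalabanLadder.NT`, conditional rung line; the YM mass gap is NOT proved).
Refs: Georgii, Gibbs Measures (2011) Thm. 4.17; Seiler LNP 159 Ch. 2; tree `LatticeGaugeDLRFarFactorProofs`. -/

set_option autoImplicit false

noncomputable section

namespace Summit.QuantumFields.YangMills.Cruxes.ResponseLocalisation.Femto

open MeasureTheory Filter Topology
open Literature.MathematicalPhysics.QuantumFieldTheory Literature.MathematicalPhysics.QuantumLattice
open Literature.Probability.LatticeModels
open Summit.QuantumFields.YangMills.Cruxes.OSLegsFromFemtoAndGap.DlrCollarTransfer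
open Summit.QuantumFields.YangMills.Cruxes.RunningCouplingCeiling.Pointwise (torusDist)

/-! ## §1 Torus representatives of the near ball -/

section Representatives

/-! The cyclic representative of `x − z` on the torus `(ℤ/(2L+1))⁴` is the vector
`fun k => ((((x k - z k : ℤ) : ZMod (2 * L + 1))).valMinAbs : ℤ)` (coordinatewise `valMinAbs`); it is written out in full below
(no definition is introduced). -/

/-- The Euclidean norm of an integer vector read in `ℝ⁴`. [folklore] -/
theorem norm_siteToE_eq_sqrt (w : Fin 4 → ℤ) : ‖siteToE w‖ = Real.sqrt (∑ k, ((w k : ℤ) : ℝ) ^ 2) := by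
  rw [EuclideanSpace.norm_eq]
  congr 1
  refine Finset.sum_congr rfl fun k _ => ?_
  rw [siteToE_apply, Real.norm_eq_abs, sq_abs]

/-- The norm of the cyclic representative of `x − z` is the torus distance of `x` and `z`. [folklore] -/
theorem norm_wrep (L : ℕ) (z x : Fin 4 → ℤ) :
    ‖siteToE (fun k : Fin 4 => ((((x k - z k : ℤ) : ZMod (2 * L + 1))).valMinAbs : ℤ))‖ = torusDist L x z := by
  rw [norm_siteToE_eq_sqrt]
  rfl

/-- A coordinate of an integer vector is bounded by its Euclidean norm. [folklore] -/
theorem abs_apply_le_norm (w : Fin 4 → ℤ) (k : Fin 4) : |((w k : ℤ) : ℝ)| ≤ ‖siteToE w‖ := by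
  have h := PiLp.norm_apply_le (siteToE w) k
  rwa [siteToE_apply, Real.norm_eq_abs] at h

/-- `z + (cyclic representative of x − z) ≡ x` coordinatewise modulo `2L+1`. [folklore] -/
theorem intCast_add_wrep (L : ℕ) (z x : Fin 4 → ℤ) (k : Fin 4) :
    (((z + (fun k : Fin 4 => ((((x k - z k : ℤ) : ZMod (2 * L + 1))).valMinAbs : ℤ))) k : ℤ) : ZMod (2 * L + 1)) =
      ((x k : ℤ) : ZMod (2 * L + 1)) := by
  simp only [Pi.add_apply, Int.cast_add, ZMod.coe_valMinAbs, Int.cast_sub]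
  ring

/-- The cyclic representative of `x − z` is injective in `x ∈ box L` (distinct box sites are incongruent mod `2L+1`). [folklore] -/
theorem wrep_injOn (L : ℕ) (z : Fin 4 → ℤ) :
    Set.InjOn (fun x : Fin 4 → ℤ => (fun k : Fin 4 => ((((x k - z k : ℤ) : ZMod (2 * L + 1))).valMinAbs : ℤ)))
      (box 4 L : Set (Fin 4 → ℤ)) := by
  intro x hx x' hx' h
  rw [Finset.mem_coe, mem_box] at hx hx'
  funext k
  have hk := congrFun h k
  simp only at hk
  have hz : ((x k - z k : ℤ) : ZMod (2 * L + 1)) = ((x' k - z k : ℤ) : ZMod (2 * L + 1)) := by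
    have := congrArg (fun t : ℤ => (t : ZMod (2 * L + 1))) hk
    simpa only [ZMod.coe_valMinAbs] using this
  have hz' : ((x k : ℤ) : ZMod (2 * L + 1)) = ((x' k : ℤ) : ZMod (2 * L + 1)) := by
    have := congrArg (fun t => t + ((z k : ℤ) : ZMod (2 * L + 1))) hz
    simpa [Int.cast_sub] using this
  rw [ZMod.intCast_eq_intCast_iff_dvd_sub] at hz'
  obtain ⟨h1, h2⟩ := hx k
  obtain ⟨h1', h2'⟩ := hx' k
  have habs : |x' k - x k| < ((2 * L + 1 : ℕ) : ℤ) := by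
    rw [abs_lt]; push_cast; constructor <;> linarith
  have := Int.eq_zero_of_abs_lt_dvd hz' habs
  linarith

/-- **Counting the near ball**: at most `(2ρ+1)⁴` sites of `box L` are within torus distance `ρ` of `z`. [folklore] -/
theorem card_filter_torusDist_lt_le (L : ℕ) (z : Fin 4 → ℤ) {ρ : ℝ} (hρ : 0 ≤ ρ) :
    ((((box 4 L).filter fun x => torusDist L x z < ρ).card : ℕ) : ℝ) ≤ (2 * ρ + 1) ^ 4 := by
  classical
  set N : ℕ := ⌊ρ⌋₊ with hN
  set T : Finset (Fin 4 → ℤ) := Fintype.piFinset fun _ : Fin 4 => Finset.Icc (-(N : ℤ)) N with hT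
  set wrep : (Fin 4 → ℤ) → (Fin 4 → ℤ) := fun x => (fun k : Fin 4 => ((((x k - z k : ℤ) : ZMod (2 * L + 1))).valMinAbs : ℤ)) with hwrep
  have hmaps : ∀ x ∈ (box 4 L).filter (fun x => torusDist L x z < ρ), wrep x ∈ T := by
    intro x hx
    rw [Finset.mem_filter] at hx
    obtain ⟨-, hd⟩ := hx
    rw [hT, Fintype.mem_piFinset]
    intro k
    rw [Finset.mem_Icc]
    have h1 : |((wrep x k : ℤ) : ℝ)| < ρ :=
      (abs_apply_le_norm _ k).trans_lt (by rw [hwrep, norm_wrep]; exact hd)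
    have h2 : |wrep x k| ≤ (N : ℤ) := by
      have h3 : ((|wrep x k| : ℤ) : ℝ) < ρ := by push_cast; exact h1
      have h5 : ((|wrep x k| : ℤ) : ℝ) < (N : ℝ) + 1 := h3.trans (by rw [hN]; exact Nat.lt_floor_add_one ρ)
      have h6 : (|wrep x k| : ℤ) < (N : ℤ) + 1 := by exact_mod_cast h5
      omega
    exact abs_le.1 h2
  have hinj : Set.InjOn wrep ((box 4 L).filter fun x => torusDist L x z < ρ) :=
    (hwrep ▸ wrep_injOn L z).mono fun x hx => by
      simp only [Finset.coe_filter, Set.mem_setOf_eq] at hx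
      exact Finset.mem_coe.2 hx.1
  have hcard := Finset.card_le_card_of_injOn wrep hmaps hinj
  have hTcard : T.card = (2 * N + 1) ^ 4 := by
    rw [hT, Fintype.card_piFinset, Finset.prod_const, Finset.card_univ, Fintype.card_fin, Int.card_Icc]
    congr 1
    omega
  rw [hTcard] at hcard
  calc ((((box 4 L).filter fun x => torusDist L x z < ρ).card : ℕ) : ℝ) ≤ ((2 * N + 1) ^ 4 : ℕ) := by
        exact_mod_cast hcard
    _ = (2 * (N : ℝ) + 1) ^ 4 := by push_cast; ring
    _ ≤ (2 * ρ + 1) ^ 4 := by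
        have : (N : ℝ) ≤ ρ := Nat.floor_le hρ
        gcongr

/-- **A far coordinate**: some coordinate of the cyclic representative of `y − z` is at least half the torus distance.
[folklore] -/
theorem exists_coord_ge_half_torusDist (L : ℕ) (y z : Fin 4 → ℤ) :
    ∃ k : Fin 4, torusDist L y z / 2 ≤ |(((((y k - z k : ℤ) : ZMod (2 * L + 1))).valMinAbs : ℤ) : ℝ)| := by
  by_contra h
  push Not at h
  set v : Fin 4 → ℝ := fun k => ((((y k - z k : ℤ) : ZMod (2 * L + 1)).valMinAbs : ℤ) : ℝ) with hv
  have hd : torusDist L y z = Real.sqrt (∑ k, v k ^ 2) := rfl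
  have hsq : torusDist L y z ^ 2 = ∑ k, v k ^ 2 := by
    rw [hd, Real.sq_sqrt (Finset.sum_nonneg fun k _ => sq_nonneg _)]
  have hlt : ∑ k, v k ^ 2 < ∑ _k : Fin 4, (torusDist L y z / 2) ^ 2 := by
    refine Finset.sum_lt_sum_of_nonempty Finset.univ_nonempty fun k _ => ?_
    have hk : |v k| < torusDist L y z / 2 := h k
    have h1 := abs_lt.1 hk
    exact sq_lt_sq' h1.1 h1.2
  simp only [Finset.sum_const, Finset.card_univ, Fintype.card_fin, nsmul_eq_mul] at hlt
  push_cast at hlt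
  nlinarith [hsq, hlt]

/-- Integer form of the far coordinate, in both orders: if `2(2M+4) ≤ d_T(y,z)` then some `|(y−z)_k|_T ≥ 2M+4` and
`|(z−y)_k|_T ≥ 2M+4`. [folklore] -/
theorem exists_coord_sep (L M : ℕ) (y z : Fin 4 → ℤ) (h : (2 * ((2 : ℝ) * M + 4)) ≤ torusDist L y z) :
    (∃ k : Fin 4, (2 * (M : ℤ) + 4) ≤ |((((y k - z k : ℤ) : ZMod (2 * L + 1))).valMinAbs : ℤ)|) ∧
    (∃ k : Fin 4, (2 * (M : ℤ) + 4) ≤ |((((z k - y k : ℤ) : ZMod (2 * L + 1))).valMinAbs : ℤ)|) := by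
  obtain ⟨k, hk⟩ := exists_coord_ge_half_torusDist L y z
  set v : ℤ := ((((y k - z k : ℤ) : ZMod (2 * L + 1))).valMinAbs : ℤ) with hv
  have h1 : (2 * (M : ℝ) + 4) ≤ |(v : ℝ)| := by linarith
  have h2 : (2 * (M : ℤ) + 4) ≤ |v| := by
    have h3 : ((2 * (M : ℤ) + 4 : ℤ) : ℝ) ≤ ((|v| : ℤ) : ℝ) := by
      rw [Int.cast_abs]; push_cast; exact h1
    exact_mod_cast h3
  refine ⟨⟨k, h2⟩, ⟨k, ?_⟩⟩
  have hneg : (((z k - y k : ℤ) : ZMod (2 * L + 1))) = -(((y k - z k : ℤ) : ZMod (2 * L + 1))) := by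
    push_cast; ring
  rw [hneg, Int.abs_eq_natAbs, ZMod.natAbs_valMinAbs_neg, ← Int.abs_eq_natAbs, ← hv]
  exact h2

end Representatives

/-! ## §2 Periodicity of the lifted action density; the shifted density inside the centred cube -/

section Periodicity

variable {G : Type} [Group G] [TopologicalSpace G] [IsTopologicalGroup G] [CompactSpace G]
  [MeasurableSpace G] [BorelSpace G] (r : LatticeRep G)

/-- **Periodicity**: the action densities at congruent sites agree on periodic configurations. [folklore] -/
theorem dens_torusLift_congr (L' : ℕ) {x x' : Fin 4 → ℤ}
    (h : ∀ k, ((x k : ℤ) : ZMod L') = ((x' k : ℤ) : ZMod L')) (V : GaugeConfig 4 L' G) :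
    dens G r x (torusLift L' V) = dens G r x' (torusLift L' V) := by
  have hcfg : (Literature.MathematicalPhysics.QuantumLattice.configShift (-x)) (torusLift L' V) =
      (Literature.MathematicalPhysics.QuantumLattice.configShift (-x')) (torusLift L' V) := by
    funext e
    rw [Literature.MathematicalPhysics.QuantumLattice.configShift_apply,
      Literature.MathematicalPhysics.QuantumLattice.configShift_apply]
    simp only [torusLift, Function.comp_apply, torusEdge]
    have hproj : Torus.proj L' (e.1 - -x) = Torus.proj L' (e.1 - -x') := by
      funext i
      simp only [Torus.proj_apply, sub_neg_eq_add, Pi.add_apply, Int.cast_add, h i]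
    rw [hproj]
  unfold dens
  rw [hcfg]

/-- `torusK3` only depends on the residue of its first site. [folklore] -/
theorem torusK3_congr_left (β : ℝ) (L : ℕ) {x x' : Fin 4 → ℤ}
    (h : ∀ k, ((x k : ℤ) : ZMod (2 * L + 1)) = ((x' k : ℤ) : ZMod (2 * L + 1))) (y z : Fin 4 → ℤ) :
    torusK3 G r β L x y z = torusK3 G r β L x' y z := by
  unfold torusK3 torusE
  simp_rw [dens_torusLift_congr r (2 * L + 1) h]

/-- The action density at `z + w` is a cylinder observable on the radius-`M+1` cube around `z` when `|w_j| + 1 ≤ M`.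
[folklore] -/
theorem isCylinder_dens_cube_shift {M : ℕ} (z w : Fin 4 → ℤ) (hw : ∀ j, |w j| + 1 ≤ (M : ℤ)) :
    IsCylinder (dens G r (z + w)) (cubeEdges (fun k => z k - (M + 1)) (2 * M + 3)) := by
  refine (isCylinder_dens r (z + w)).mono (Finset.coe_subset.2 fun e he => ?_)
  have h01 := near_of_mem_supp_dens r he
  unfold cubeEdges cubeSites
  simp only [Finset.mem_filter, Finset.mem_product, Finset.mem_univ, and_true, Fintype.mem_piFinset,
    Finset.mem_Ico, Pi.add_apply, Pi.single_apply]
  refine ⟨fun j => ?_, fun j => ?_⟩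
  · obtain ⟨h0, h1⟩ := h01 j
    simp only [Pi.add_apply] at h0 h1
    have hwj := abs_le.1 (show |w j| ≤ (M : ℤ) - 1 by linarith [hw j])
    push_cast
    constructor <;> omega
  · obtain ⟨h0, h1⟩ := h01 j
    simp only [Pi.add_apply] at h0 h1
    have hwj := abs_le.1 (show |w j| ≤ (M : ℤ) - 1 by linarith [hw j])
    split_ifs <;> push_cast <;> constructor <;> omega

omit [Group G] [TopologicalSpace G] [IsTopologicalGroup G] [CompactSpace G] [MeasurableSpace G] [BorelSpace G] in
/-- The site `z + w` has depth `≥ M + 2 − N` in the radius-`M+1` cube around `z` when `|w_j| ≤ N`. [folklore] -/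
theorem depth_centred_shift_ge (z w : Fin 4 → ℤ) (M N : ℕ) (hw : ∀ j, |w j| ≤ (N : ℤ)) :
    M + 2 - N ≤ depth (fun k => z k - (M + 1)) (2 * M + 3) (z + w) := by
  unfold depth
  refine Finset.le_inf' _ _ fun j _ => ?_
  have h := abs_le.1 (hw j)
  simp only [Pi.add_apply]
  rw [le_min_iff]
  constructor <;> omega

end Periodicity

/-! ## §3 Kernel algebra and the two-observable collar bound -/

section Collar

variable {G : Type} [Group G] [TopologicalSpace G] [IsTopologicalGroup G] [CompactSpace G]
  [MeasurableSpace G] [BorelSpace G] [SecondCountableTopology G] (r : LatticeRep G)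

/-- **Kernel algebra**: `γ_η((F − p)(H − q)) = kerCov_η(F, H) + (γ_η F − p)(γ_η H − q)` for bounded continuous `F, H`.
[folklore] -/
theorem kerE_centred_mul (β : ℝ) (c : Fin 4 → ℤ) (b : ℕ) (η : LGConfig 4 G) {F H : LGConfig 4 G → ℝ}
    (hF : Continuous F) (hH : Continuous H) {CF CH : ℝ} (hFb : ∀ U, |F U| ≤ CF) (hHb : ∀ U, |H U| ≤ CH)
    (p q : ℝ) :
    kerE G r β c b η (fun U => (F U - p) * (H U - q)) =
      kerCov G r β c b η F H + (kerE G r β c b η F - p) * (kerE G r β c b η H - q) := by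
  unfold kerCov kerE
  haveI := isProbabilityMeasure_ymSpecification r.ρ r.continuous β (cubeEdges c b) η
  set ν := ymSpecification (d := 4) r.ρ β (cubeEdges c b) η with hν
  have hFi : Integrable F ν := integrable_of_abs_le hF.measurable hFb
  have hHi : Integrable H ν := integrable_of_abs_le hH.measurable hHb
  have hFHi : Integrable (fun U => F U * H U) ν := by
    refine integrable_of_abs_le (hF.mul hH).measurable (C := CF * CH) fun U => ?_
    rw [abs_mul]
    exact mul_le_mul (hFb U) (hHb U) (abs_nonneg _) ((abs_nonneg _).trans (hFb U))
  have e1 : (fun U => (F U - p) * (H U - q)) = fun U => ((F U * H U - q * F U) - p * H U) + p * q := by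
    funext U; ring
  have i1 : Integrable (fun U => F U * H U - q * F U) ν := hFHi.sub (hFi.const_mul q)
  have i2 : Integrable (fun U => (F U * H U - q * F U) - p * H U) ν := i1.sub (hHi.const_mul p)
  rw [e1, integral_add i2 (integrable_const _), integral_sub i1 (hHi.const_mul p), integral_sub hFHi (hFi.const_mul q),
    integral_const_mul, integral_const_mul, integral_const, smul_eq_mul, probReal_univ, one_mul]
  ring

/-- **The torus mean of a collared observable**: if every kernel mean `γ_Λ A (η)` is within `ε` of `p`, so is the torus mean
`⟨A⟩` (one DLR step with trivial far factor). [folklore] -/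
theorem abs_torusMean_sub_le (β : ℝ) {L' : ℕ} [NeZero L'] (Λ S : Finset (Literature.MathematicalPhysics.QuantumLattice.ZdEdge 4)) {A : LGConfig 4 G → ℝ}
    (hAc : Continuous A) {CA : ℝ} (hAb : ∀ U, |A U| ≤ CA) (hAS : IsCylinder A S)
    (hinj : Set.InjOn (Torus.proj L')
      ((Λ ∪ S ∪ (plaquettesTouching Λ).biUnion plaquetteEdges).image Prod.fst : Set (Site 4)))
    {p ε : ℝ} (hker : ∀ η, |(∫ U, A U ∂(ymSpecification r.ρ β Λ η)) - p| ≤ ε) :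
    |(∫ W, A (torusLift L' W) ∂(wilsonMeasure r.ρ β)) - p| ≤ ε := by
  haveI := isProbabilityMeasure_wilsonMeasure (d := 4) (L := L') r.ρ r.continuous β
  have h1 := integral_torusLift_mul_eq_integral_ymSpecification_mul r.ρ r.continuous β Λ hAc hAb hAS hinj
    (H := fun _ => (1 : ℝ)) measurable_const (D := 1) (fun _ => by simp) (fun _ _ => rfl)
  simp only [mul_one] at h1
  rw [h1]
  have hgc : Continuous fun η => ∫ U, A U ∂(ymSpecification r.ρ β Λ η) :=
    continuous_integral_ymSpecification r.ρ r.continuous β Λ hAc hAb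
  have hgb : ∀ η, |∫ U, A U ∂(ymSpecification r.ρ β Λ η)| ≤ CA := fun η =>
    abs_integral_ymSpecification_le r.ρ r.continuous β Λ hAb η
  rw [← integral_sub_const_of_abs_le (f := fun V => ∫ U, A U ∂(ymSpecification r.ρ β Λ (torusLift L' V)))
    ((hgc.comp (continuous_torusLift L')).measurable) (fun V => hgb _) p]
  exact abs_integral_le_of_abs_le fun V => hker _

/-- Mean of an affine image `t·(A − q) + p` under a probability measure. [folklore] -/
theorem integral_affine {X : Type*} [MeasurableSpace X] {μ : Measure X} [IsProbabilityMeasure μ]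
    {A : X → ℝ} (hA : Measurable A) {CA : ℝ} (hAb : ∀ x, |A x| ≤ CA) (t q p : ℝ) :
    ∫ x, (t * (A x - q) + p) ∂μ = t * ((∫ x, A x ∂μ) - q) + p := by
  have hi : Integrable (fun x => t * (A x - q)) μ :=
    ((integrable_of_abs_le hA hAb).sub (integrable_const q)).const_mul t
  rw [integral_add hi (integrable_const p), integral_const_mul, integral_sub_const_of_abs_le hA hAb q, integral_const,
    smul_eq_mul, probReal_univ, one_mul]

/-- **Two-observable collar bound with separate tolerances.**  On the torus of side `L'`, let `A₁, A₂` be bounded continuous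
cylinder observables (supports `S₁, S₂`) with volumes `Λ₁, Λ₂` satisfying the injectivity and separation side conditions of the
tree's `abs_integral_prod_sub_mean_le`, and suppose the kernel means are exterior-uniformly close to constants:
`|γ_{Λ₁}A₁(η) − p₁| ≤ ε₁`, `|γ_{Λ₂}A₂(η) − p₂| ≤ ε₂` (`ε₁, ε₂ > 0`).  Then `|⟨(A₁ − ⟨A₁⟩)(A₂ − ⟨A₂⟩)⟩| ≤ 4 ε₁ ε₂`
(the `n = 2` case of the tree bound, applied to `A₁` and the rescaled `(ε₁/ε₂)(A₂ − p₂) + p₁`). [folklore] -/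
theorem abs_integral_two_sub_mean_le (β : ℝ) {L' : ℕ} [NeZero L']
    (Λ₁ S₁ Λ₂ S₂ : Finset (Literature.MathematicalPhysics.QuantumLattice.ZdEdge 4)) {A₁ A₂ : LGConfig 4 G → ℝ}
    (h1c : Continuous A₁) (h2c : Continuous A₂) {B₁ B₂ : ℝ} (h1b : ∀ U, |A₁ U| ≤ B₁) (h2b : ∀ U, |A₂ U| ≤ B₂)
    (h1S : IsCylinder A₁ S₁) (h2S : IsCylinder A₂ S₂)
    (hinj₁ : Set.InjOn (Torus.proj L')
      ((Λ₁ ∪ S₁ ∪ (plaquettesTouching Λ₁).biUnion plaquetteEdges).image Prod.fst : Set (Site 4)))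
    (hinj₂ : Set.InjOn (Torus.proj L')
      ((Λ₂ ∪ S₂ ∪ (plaquettesTouching Λ₂).biUnion plaquetteEdges).image Prod.fst : Set (Site 4)))
    (hfar₁₂ : ∀ e ∈ S₂ ∪ (plaquettesTouching Λ₂).biUnion plaquetteEdges, ∀ e' ∈ Λ₁,
      torusEdge L' e ≠ torusEdge L' e')
    (hfar₂₁ : ∀ e ∈ S₁ ∪ (plaquettesTouching Λ₁).biUnion plaquetteEdges, ∀ e' ∈ Λ₂,
      torusEdge L' e ≠ torusEdge L' e')
    {p₁ p₂ ε₁ ε₂ : ℝ} (hε₁ : 0 < ε₁) (hε₂ : 0 < ε₂)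
    (hk₁ : ∀ η, |(∫ U, A₁ U ∂(ymSpecification r.ρ β Λ₁ η)) - p₁| ≤ ε₁)
    (hk₂ : ∀ η, |(∫ U, A₂ U ∂(ymSpecification r.ρ β Λ₂ η)) - p₂| ≤ ε₂) :
    |∫ V, (A₁ (torusLift L' V) - ∫ W, A₁ (torusLift L' W) ∂(wilsonMeasure r.ρ β)) *
        (A₂ (torusLift L' V) - ∫ W, A₂ (torusLift L' W) ∂(wilsonMeasure r.ρ β)) ∂(wilsonMeasure r.ρ β)|
      ≤ 4 * ε₁ * ε₂ := by
  classical
  haveI := isProbabilityMeasure_wilsonMeasure (d := 4) (L := L') r.ρ r.continuous β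
  set t : ℝ := ε₁ / ε₂ with ht
  have ht0 : 0 < t := div_pos hε₁ hε₂
  -- the rescaled second observable
  set Bf : LGConfig 4 G → ℝ := fun U => t * (A₂ U - p₂) + p₁ with hBf
  have hBc : Continuous Bf := (continuous_const.mul (h2c.sub continuous_const)).add continuous_const
  have hBb : ∀ U, |Bf U| ≤ t * (B₂ + |p₂|) + |p₁| := fun U => by
    simp only [hBf]
    calc |t * (A₂ U - p₂) + p₁| ≤ |t * (A₂ U - p₂)| + |p₁| := abs_add_le _ _
      _ ≤ t * (B₂ + |p₂|) + |p₁| := by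
          rw [abs_mul, abs_of_pos ht0]
          gcongr
          exact (abs_sub _ _).trans (add_le_add (h2b U) le_rfl)
  have hBS : IsCylinder Bf S₂ := fun U V hUV => by simp only [hBf, h2S hUV]
  have hBker : ∀ η, |(∫ U, Bf U ∂(ymSpecification r.ρ β Λ₂ η)) - p₁| ≤ ε₁ := by
    intro η
    haveI := isProbabilityMeasure_ymSpecification r.ρ r.continuous β Λ₂ η
    have e1 : ∫ U, Bf U ∂(ymSpecification r.ρ β Λ₂ η) =
        t * ((∫ U, A₂ U ∂(ymSpecification r.ρ β Λ₂ η)) - p₂) + p₁ := by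
      simp only [hBf]
      exact integral_affine h2c.measurable h2b t p₂ p₁
    rw [e1, add_sub_cancel_right, abs_mul, abs_of_pos ht0]
    calc t * |(∫ U, A₂ U ∂(ymSpecification r.ρ β Λ₂ η)) - p₂| ≤ t * ε₂ :=
          mul_le_mul_of_nonneg_left (hk₂ η) ht0.le
      _ = ε₁ := by rw [ht]; field_simp
  -- common sup bound
  set CA : ℝ := max B₁ (t * (B₂ + |p₂|) + |p₁|) with hCA
  -- the data of the abstract collar bound, indexed by `Fin 2`
  set A : Fin 2 → LGConfig 4 G → ℝ := ![A₁, Bf] with hA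
  set Λ : Fin 2 → Finset (Literature.MathematicalPhysics.QuantumLattice.ZdEdge 4) := ![Λ₁, Λ₂] with hΛ
  set S : Fin 2 → Finset (Literature.MathematicalPhysics.QuantumLattice.ZdEdge 4) := ![S₁, S₂] with hS
  have hA0 : A 0 = A₁ := rfl
  have hA1 : A 1 = Bf := rfl
  have hAc : ∀ i, Continuous (A i) := Fin.forall_fin_two.2 ⟨h1c, hBc⟩
  have hAb : ∀ i U, |A i U| ≤ CA := Fin.forall_fin_two.2
    ⟨fun U => (h1b U).trans (le_max_left _ _), fun U => (hBb U).trans (le_max_right _ _)⟩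
  have hAS : ∀ i, IsCylinder (A i) (S i) := Fin.forall_fin_two.2 ⟨h1S, hBS⟩
  have hinj : ∀ i, Set.InjOn (Torus.proj L')
      ((Λ i ∪ S i ∪ (plaquettesTouching (Λ i)).biUnion plaquetteEdges).image Prod.fst : Set (Site 4)) :=
    Fin.forall_fin_two.2 ⟨hinj₁, hinj₂⟩
  have hfar : ∀ i j, i ≠ j → ∀ e ∈ S j ∪ (plaquettesTouching (Λ j)).biUnion plaquetteEdges, ∀ e' ∈ Λ i,
      torusEdge L' e ≠ torusEdge L' e' := by
    refine Fin.forall_fin_two.2 ⟨Fin.forall_fin_two.2 ⟨fun h => (h rfl).elim, fun _ => hfar₁₂⟩,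
      Fin.forall_fin_two.2 ⟨fun _ => hfar₂₁, fun h => (h rfl).elim⟩⟩
  set m : Fin 2 → ℝ := fun i => ∫ W, A i (torusLift L' W) ∂(wilsonMeasure r.ρ β) with hm
  have hker : ∀ i η, |(∫ U, A i U ∂(ymSpecification r.ρ β (Λ i) η)) - p₁| ≤ ε₁ :=
    Fin.forall_fin_two.2 ⟨hk₁, hBker⟩
  have key := abs_integral_prod_sub_mean_le (d := 4) r.ρ r.continuous β (L := L') (n := 2) Λ S A hAc hAb hAS hinj
    hfar m (fun i => rfl) hker
  -- unfold the product over `Fin 2`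
  set m₁ : ℝ := ∫ W, A₁ (torusLift L' W) ∂(wilsonMeasure r.ρ β) with hm₁
  set m₂ : ℝ := ∫ W, A₂ (torusLift L' W) ∂(wilsonMeasure r.ρ β) with hm₂
  have hmB : m 1 = t * (m₂ - p₂) + p₁ := by
    simp only [hm, hA1, hBf]
    exact integral_affine ((h2c.comp (continuous_torusLift L')).measurable) (fun W => h2b _) t p₂ p₁
  have hm0 : m 0 = m₁ := rfl
  have hprod : ∀ V, ∏ i, (A i (torusLift L' V) - m i) =
      t * ((A₁ (torusLift L' V) - m₁) * (A₂ (torusLift L' V) - m₂)) := by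
    intro V
    rw [Fin.prod_univ_two, hm0, hmB, hA0, hA1]
    simp only [hBf]
    ring
  simp only [hprod] at key
  rw [integral_const_mul, abs_mul, abs_of_pos ht0] at key
  -- `t · |I| ≤ (2ε₁)²` ⇒ `|I| ≤ 4 ε₁ ε₂`
  have hI : |∫ V, (A₁ (torusLift L' V) - m₁) * (A₂ (torusLift L' V) - m₂) ∂(wilsonMeasure r.ρ β)| ≤
      (2 * ε₁) ^ 2 / t := by
    rw [le_div_iff₀ ht0, mul_comm]
    exact key
  calc |∫ V, (A₁ (torusLift L' V) - m₁) * (A₂ (torusLift L' V) - m₂) ∂(wilsonMeasure r.ρ β)|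
      ≤ (2 * ε₁) ^ 2 / t := hI
    _ = 4 * ε₁ * ε₂ := by rw [ht]; field_simp; ring

end Collar

end Summit.QuantumFields.YangMills.Cruxes.ResponseLocalisation.Femto

end
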